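import Mathlib
import Literature.Computability.AlgebraicComplexity.GlynnMultilinearSigmaPiSigma
import Summits.ValiantsHypothesis.ValiantsHypothesis.Theorems.RigidityForcesSymmetryRankRigidMinimalReprStubLevelBound
import Summits.ValiantsHypothesis.ValiantsHypothesis.Theorems.RigidityForcesSymmetryRankRigidMinimalReprLaplaceDefs

/-!
# The engine of the tied level counts: Laplace optimality of order `k + 1` ⇒ the level count for the tie `k`
# (crux `RankRigidMinimalRepr`, stmt-ValiantsHypothesis-18034, route `RigidityForcesSymmetry`)

THEOREM (`levelBound_of_laplaceOptimal`).  If `LaplaceOptimal (k + 1)` holds (`…LaplaceDefs.lean`: every expression of the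
permutation pattern `[v injective]` on `Fin (k+1) → Fin (k+1)` as a finite sum of split-rank-one terms
`u_t(v|_{S_t}) · w_t(v|_{S_tᶜ})` has `Σ_t |S_t|! (k+1-|S_t|)! ≥ (k+1)!`), then for all `m ≥ k + 1`, `s ≤ m` and `w`:

  `TiedLevelDecomposable m k s w → m.choose s ≤ w`

— every level-`s` typed decomposition of `perm_m` with the `k + 1` columns `0, …, k` tied uses at least `C(m, s)` products.
This is the common generalisation of the landed `stub_levelBound` (`k = 1`, via `LaplaceOptimal 2` = rank of
`[[0,1],[1,0]]`) and `levelBound_threeTied` (`k = 2`, via `LaplaceOptimal 3` = slice rank of `P_3`); the instances are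
re-derived from it in `…LaplaceOptimalSmall.lean`.  A future proof of the FINITE statement `LaplaceOptimal 4` yields the
level count for four tied columns with no further work.

**Proof (block double count with factorial weights).**  The block of `σ` = graph monomials of the block maps
`tauD σ v`; perm on it = `[v injective]` (`coeff_tauD_perPoly`); a typed product's block is `u_t(v|_{S_t}) w_t(v|_{S_tᶜ})`,
`S_t = {i : σ⁻¹ i ∈ I_t}` (unique factorisation, `graphMonomialOn_tauD_congr`); a touching node has `|S_t| = ct_t`,
`σ(I_t) = C_t ∪ S_t` (`ct_eq_of_mem_support_tauD`, `symm_mem_iff_of_mem_support_tauD`).  Score `ct_t!(k+1-ct_t)!`: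
DEMAND `≥ (k+1)!` per `σ` (`factorial_le_sum_scoreD`, = `LaplaceOptimal`), SUPPLY `≤ (k+1)! s!(m-s)!` per node
(`sum_scoreD_le`: `C(k+1,ct)` candidate images, each hit `≤ s!(m-s)!` times, `card_perm_map_eq_le`), COUNT
(`choose_le_of_laplaceOptimal`).

HONEST FRAMING: a helper (unregistered) toward the rungs `TiedTorusBound k` of crux `RankRigidMinimalRepr`; each rung
also needs the dictionary stub `stub_levelDecomp`.  CAVEAT: `LaplaceOptimal d` for all `d` would give Grenet-optimality
under the LEFT torus alone (unordered set-multilinear ABP lower bounds for the permanent — open, Arvind–Raja 2016), so the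
finite inputs must get hard with `d`.  No bearing on `VP ≠ VNP`.
-/

set_option autoImplicit false

-- the mandated summit-side namespace repeats a component by design (single-problem summit)
set_option linter.dupNamespace false

open MvPolynomial Finset
open Literature.Computability.AlgebraicComplexity
open Summit.ValiantsHypothesis.ValiantsHypothesis.Theorems.RigidityForcesSymmetryPairTiedTorusBound

namespace Summit.ValiantsHypothesis.ValiantsHypothesis.Theorems.RigidityForcesSymmetryRankRigidMinimalRepr

noncomputable section

open scoped Classical

variable {k m : ℕ} (hd : k + 1 ≤ m)

/-! ### §1 The block map `tauD` -/

/-- Value of the block map at the tied row `σ⁻¹ i`: the tied column `v i`. -/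
theorem tauD_apply_symm_castLE (σ : Equiv.Perm (Fin m)) (v : Fin (k + 1) → Fin (k + 1)) (i : Fin (k + 1)) :
    tauD hd σ v (σ.symm (Fin.castLE hd i)) = Fin.castLE hd (v i) := by
  unfold tauD
  have h : ((σ (σ.symm (Fin.castLE hd i))) : ℕ) < k + 1 := by
    rw [Equiv.apply_symm_apply, Fin.val_castLE]; exact i.isLt
  rw [dif_pos h]
  exact congrArg _ (congrArg v (Fin.ext (by simp)))

/-- Value of the block map at a row `x` with `σ x` untied: `σ x`. -/
theorem tauD_apply_of_le (σ : Equiv.Perm (Fin m)) (v : Fin (k + 1) → Fin (k + 1)) {x : Fin m}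
    (hx : k + 1 ≤ (σ x).val) : tauD hd σ v x = σ x := by
  unfold tauD
  rw [dif_neg (by omega)]

/-- Value of the block map at a row `x` with `σ x` tied: the tied column `v (σ x)`. -/
theorem tauD_apply_of_lt (σ : Equiv.Perm (Fin m)) (v : Fin (k + 1) → Fin (k + 1)) {x : Fin m}
    (hx : (σ x).val < k + 1) : tauD hd σ v x = Fin.castLE hd (v ⟨(σ x).val, hx⟩) := by
  unfold tauD
  rw [dif_pos hx]

/-- The block map is tied exactly where `σ` is. -/
theorem val_tauD_lt_iff (σ : Equiv.Perm (Fin m)) (v : Fin (k + 1) → Fin (k + 1)) (x : Fin m) :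
    (tauD hd σ v x).val < k + 1 ↔ (σ x).val < k + 1 := by
  by_cases hx : (σ x).val < k + 1
  · rw [tauD_apply_of_lt hd σ v hx, Fin.val_castLE]
    exact ⟨fun _ => hx, fun _ => (v _).isLt⟩
  · rw [tauD_apply_of_le hd σ v (by omega)]

/-- The block map hits an untied column `j` exactly where `σ` does. -/
theorem tauD_eq_iff_of_untied (σ : Equiv.Perm (Fin m)) (v : Fin (k + 1) → Fin (k + 1)) {j : Fin m}
    (hj : k + 1 ≤ j.val) (x : Fin m) : tauD hd σ v x = j ↔ σ x = j := by
  by_cases hx : (σ x).val < k + 1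
  · rw [tauD_apply_of_lt hd σ v hx]
    constructor
    · intro h
      have := congrArg Fin.val h
      rw [Fin.val_castLE] at this
      have := (v ⟨(σ x).val, hx⟩).isLt
      omega
    · intro h; rw [h] at hx; omega
  · rw [tauD_apply_of_le hd σ v (by omega)]

/-- The block map on the rows of `I` depends on `v` only through the positions `i` with `σ⁻¹ i ∈ I`. -/
theorem graphMonomialOn_tauD_congr (σ : Equiv.Perm (Fin m)) (I : Finset (Fin m)) {v v' : Fin (k + 1) → Fin (k + 1)}
    (h : ∀ i : Fin (k + 1), σ.symm (Fin.castLE hd i) ∈ I → v i = v' i) :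
    graphMonomialOn I (tauD hd σ v) = graphMonomialOn I (tauD hd σ v') := by
  refine graphMonomialOn_congr fun x hx => ?_
  by_cases hlt : (σ x).val < k + 1
  · rw [tauD_apply_of_lt hd σ v hlt, tauD_apply_of_lt hd σ v' hlt, h ⟨(σ x).val, hlt⟩ ?_]
    have : Fin.castLE hd ⟨(σ x).val, hlt⟩ = σ x := Fin.ext (by simp)
    rwa [this, Equiv.symm_apply_apply]
  · rw [tauD_apply_of_le hd σ v (by omega), tauD_apply_of_le hd σ v' (by omega)]

/-- The block map is injective iff the assignment of tied columns is. -/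
theorem injective_tauD_iff (σ : Equiv.Perm (Fin m)) (v : Fin (k + 1) → Fin (k + 1)) :
    Function.Injective (tauD hd σ v) ↔ Function.Injective v := by
  constructor
  · intro hinj i j hij
    have := hinj (a₁ := σ.symm (Fin.castLE hd i)) (a₂ := σ.symm (Fin.castLE hd j))
      (by rw [tauD_apply_symm_castLE, tauD_apply_symm_castLE, hij])
    exact Fin.castLE_injective hd (σ.symm.injective this)
  · intro hv x y hxy
    by_cases hx : (σ x).val < k + 1 <;> by_cases hy : (σ y).val < k + 1
    · rw [tauD_apply_of_lt hd σ v hx, tauD_apply_of_lt hd σ v hy] at hxy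
      have h1 := hv (Fin.castLE_injective hd hxy)
      have h2 : (σ x).val = (σ y).val := Fin.mk.inj_iff.mp h1
      exact σ.injective (Fin.ext h2)
    · have := (val_tauD_lt_iff hd σ v x).2 hx
      rw [hxy, val_tauD_lt_iff] at this; exact absurd this hy
    · have := (val_tauD_lt_iff hd σ v y).2 hy
      rw [← hxy, val_tauD_lt_iff] at this; exact absurd this hx
    · rw [tauD_apply_of_le hd σ v (by omega), tauD_apply_of_le hd σ v (by omega)] at hxy
      exact σ.injective hxy

/-- **The permanent on the block is the permutation pattern**: the coefficient of the graph monomial of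
`tauD hd σ v` in `perm_m` is `[v injective]`. -/
theorem coeff_tauD_perPoly (σ : Equiv.Perm (Fin m)) (v : Fin (k + 1) → Fin (k + 1)) :
    coeff (graphMonomial (tauD hd σ v)) (perPoly (Fin m) ℂ) = if Function.Injective v then 1 else 0 := by
  rw [coeff_graphMonomial_perPoly]
  by_cases h : Function.Injective v
  · rw [if_pos h, if_pos ((injective_tauD_iff hd σ v).2 h).bijective_of_finite]
  · rw [if_neg h, if_neg (fun hb => h ((injective_tauD_iff hd σ v).1 hb.1))]

/-! ### §2 What a typed polynomial sees on the block -/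

/-- Untied columns: `σ⁻¹ j ∈ I ↔ c j = 1`. -/
theorem symm_mem_iff_of_mem_support_tauD {I : Finset (Fin m)} {c : Fin m → ℕ} {ct : ℕ}
    {P : MvPolynomial (Fin m × Fin m) ℂ} (hP : IsTiedTyped m k I c ct P) (σ : Equiv.Perm (Fin m))
    {v : Fin (k + 1) → Fin (k + 1)} (hmem : graphMonomialOn I (tauD hd σ v) ∈ P.support) {j : Fin m}
    (hj : k < j.val) : σ.symm j ∈ I ↔ c j = 1 := by
  have h2 := (hP _ hmem).2.1 j hj
  rw [sum_graphMonomialOn_col] at h2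
  have hfilter : (I.filter fun x => tauD hd σ v x = j) = I.filter fun x => x = σ.symm j := by
    refine Finset.filter_congr fun x _ => ?_
    rw [tauD_eq_iff_of_untied hd σ v (by omega), Equiv.eq_symm_apply]
  rw [hfilter, Finset.filter_eq'] at h2
  by_cases h : σ.symm j ∈ I
  · rw [if_pos h, Finset.card_singleton] at h2
    exact ⟨fun _ => h2.symm, fun _ => h⟩
  · rw [if_neg h, Finset.card_empty] at h2
    refine ⟨fun h' => absurd h' h, fun h' => ?_⟩
    omega

/-- The set of tied positions `i < k + 1` whose row `σ⁻¹ i` lies in `I`, transported to rows, is the set of rows of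
`I` with a tied image. -/
theorem image_filter_symm_castLE_mem (σ : Equiv.Perm (Fin m)) (I : Finset (Fin m)) :
    ((Finset.univ.filter fun i : Fin (k + 1) => σ.symm (Fin.castLE hd i) ∈ I).image
        fun i => σ.symm (Fin.castLE hd i)) = I.filter fun x => (σ x).val < k + 1 := by
  ext x
  rw [Finset.mem_image, Finset.mem_filter]
  constructor
  · rintro ⟨i, hi, rfl⟩
    rw [Finset.mem_filter] at hi
    refine ⟨hi.2, ?_⟩
    rw [Equiv.apply_symm_apply, Fin.val_castLE]
    exact i.isLt
  · rintro ⟨hx, hlt⟩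
    refine ⟨⟨(σ x).val, hlt⟩, ?_, ?_⟩
    · rw [Finset.mem_filter]
      have : Fin.castLE hd ⟨(σ x).val, hlt⟩ = σ x := Fin.ext (by simp)
      rw [this, Equiv.symm_apply_apply]
      exact ⟨Finset.mem_univ _, hx⟩
    · have : Fin.castLE hd ⟨(σ x).val, hlt⟩ = σ x := Fin.ext (by simp)
      rw [this, Equiv.symm_apply_apply]

/-- Tied total: `ct = #{i < k + 1 : σ⁻¹ i ∈ I}`. -/
theorem ct_eq_of_mem_support_tauD {I : Finset (Fin m)} {c : Fin m → ℕ} {ct : ℕ}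
    {P : MvPolynomial (Fin m × Fin m) ℂ} (hP : IsTiedTyped m k I c ct P) (σ : Equiv.Perm (Fin m))
    {v : Fin (k + 1) → Fin (k + 1)} (hmem : graphMonomialOn I (tauD hd σ v) ∈ P.support) :
    ct = (Finset.univ.filter fun i : Fin (k + 1) => σ.symm (Fin.castLE hd i) ∈ I).card := by
  have h3 := (hP _ hmem).2.2
  simp_rw [sum_graphMonomialOn_col] at h3
  rw [Finset.sum_card_fiberwise_eq_card_filter] at h3
  have hfilter : (I.filter fun x => tauD hd σ v x ∈ Finset.univ.filter (fun j : Fin m => j.val ≤ k)) =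
      I.filter fun x => (σ x).val < k + 1 := by
    refine Finset.filter_congr fun x _ => ?_
    rw [Finset.mem_filter, ← Nat.lt_succ_iff, val_tauD_lt_iff hd σ v x]
    simp
  rw [hfilter, ← image_filter_symm_castLE_mem hd σ I, Finset.card_image_of_injective] at h3
  · exact h3.symm
  · intro i j hij
    exact Fin.castLE_injective hd (σ.symm.injective hij)

/-! ### §3 The engine: `LaplaceOptimal (k + 1)` ⇒ the level count for the tie `k` -/

variable {s w : ℕ} (I : Fin w → Finset (Fin m)) (c c' : Fin w → Fin m → ℕ) (ct ct' : Fin w → ℕ)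
  (P Q : Fin w → MvPolynomial (Fin m × Fin m) ℂ)

/-- **Supply.**  With the weight `ct! · (k + 1 - ct)!` for a node of tied total `ct`, a node of a level-`s` typed
decomposition (tie `k`) collects at most `(k+1)! · s! · (m-s)!` over all permutations it touches: a touched `σ` maps `I_t`
onto `C_t ∪ E` with `E` a `ct`-set of tied columns (`C(k+1, ct)` candidates), each attained by `≤ s!(m-s)!` permutations
(`card_perm_map_eq_le`), and `C(k+1, ct) · ct! · (k+1-ct)! = (k+1)!`. -/
theorem sum_scoreD_le {t : Fin w} (hcard : (I t).card = s) (hP : IsTiedTyped m k (I t) (c t) (ct t) (P t))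
    (hQ : IsTiedTyped m k (I t)ᶜ (c' t) (ct' t) (Q t)) :
    (∑ σ : Equiv.Perm (Fin m),
      if (∃ v : Fin (k + 1) → Fin (k + 1), coeff (graphMonomial (tauD hd σ v)) (P t * Q t) ≠ 0)
      then (ct t).factorial * (k + 1 - ct t).factorial else 0) ≤
      (k + 1).factorial * (s.factorial * (m - s).factorial) := by
  set cand : Finset (Finset (Fin m)) := ((Finset.univ : Finset (Fin (k + 1))).powersetCard (ct t)).image
    (fun E => (Finset.univ.filter fun j : Fin m => k < j.val ∧ c t j = 1) ∪ E.image (Fin.castLE hd)) with hcand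
  -- (1) a touched permutation maps `I t` onto a candidate
  have hmem : ∀ σ : Equiv.Perm (Fin m),
      (∃ v : Fin (k + 1) → Fin (k + 1), coeff (graphMonomial (tauD hd σ v)) (P t * Q t) ≠ 0) →
      (I t).map σ.toEmbedding ∈ cand := by
    rintro σ ⟨v, hne⟩
    rw [coeff_graphMonomial_mul_of_isTiedTyped hP hQ] at hne
    have hsupp : graphMonomialOn (I t) (tauD hd σ v) ∈ (P t).support :=
      mem_support_iff.2 (left_ne_zero_of_mul hne)
    rw [hcand, Finset.mem_image]
    refine ⟨Finset.univ.filter fun i : Fin (k + 1) => σ.symm (Fin.castLE hd i) ∈ I t, ?_, ?_⟩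
    · rw [Finset.mem_powersetCard]
      exact ⟨Finset.subset_univ _, (ct_eq_of_mem_support_tauD hd hP σ hsupp).symm⟩
    · have key : ∀ j : Fin m,
          j ∈ (Finset.univ.filter fun j : Fin m => k < j.val ∧ c t j = 1) ∪
              (Finset.univ.filter fun i : Fin (k + 1) => σ.symm (Fin.castLE hd i) ∈ I t).image (Fin.castLE hd) ↔
            σ.symm j ∈ I t := by
        intro j
        rw [Finset.mem_union, Finset.mem_image]
        constructor
        · rintro (h | ⟨i, hi, rfl⟩)
          · rw [Finset.mem_filter] at h
            exact (symm_mem_iff_of_mem_support_tauD hd hP σ hsupp h.2.1).2 h.2.2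
          · rw [Finset.mem_filter] at hi
            exact hi.2
        · intro h
          by_cases hj : k < j.val
          · exact Or.inl (Finset.mem_filter.2 ⟨Finset.mem_univ _, hj,
              (symm_mem_iff_of_mem_support_tauD hd hP σ hsupp hj).1 h⟩)
          · have hjlt : j.val < k + 1 := by omega
            have hji : Fin.castLE hd ⟨j.val, hjlt⟩ = j := Fin.ext (by simp)
            refine Or.inr ⟨⟨j.val, hjlt⟩, Finset.mem_filter.2 ⟨Finset.mem_univ _, ?_⟩, hji⟩
            rw [hji]; exact h
      ext j
      rw [Finset.mem_map_equiv]
      exact key j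
  -- (2) hence at most `|cand| · s!(m-s)!` permutations are touched
  have hT : (Finset.univ.filter fun σ : Equiv.Perm (Fin m) =>
        ∃ v : Fin (k + 1) → Fin (k + 1), coeff (graphMonomial (tauD hd σ v)) (P t * Q t) ≠ 0).card
      ≤ cand.card * (s.factorial * (m - s).factorial) := by
    calc (Finset.univ.filter fun σ : Equiv.Perm (Fin m) =>
          ∃ v : Fin (k + 1) → Fin (k + 1), coeff (graphMonomial (tauD hd σ v)) (P t * Q t) ≠ 0).card
        ≤ (cand.biUnion fun J =>
            Finset.univ.filter fun σ : Equiv.Perm (Fin m) => (I t).map σ.toEmbedding = J).card := by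
          refine Finset.card_le_card fun σ hσ => ?_
          rw [Finset.mem_filter] at hσ
          rw [Finset.mem_biUnion]
          exact ⟨_, hmem σ hσ.2, Finset.mem_filter.2 ⟨Finset.mem_univ _, rfl⟩⟩
      _ ≤ ∑ J ∈ cand, (Finset.univ.filter fun σ : Equiv.Perm (Fin m) => (I t).map σ.toEmbedding = J).card :=
          Finset.card_biUnion_le
      _ ≤ ∑ _J ∈ cand, s.factorial * (m - s).factorial :=
          Finset.sum_le_sum fun J _ => by
            have := card_perm_map_eq_le (I t) J
            rwa [hcard] at this
      _ = cand.card * (s.factorial * (m - s).factorial) := by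
          rw [Finset.sum_const, smul_eq_mul]
  -- (3) weight · |cand| ≤ (k+1)!
  have hwc : (ct t).factorial * (k + 1 - ct t).factorial * cand.card ≤ (k + 1).factorial := by
    have hle : cand.card ≤ (k + 1).choose (ct t) := by
      refine Finset.card_image_le.trans ?_
      rw [Finset.card_powersetCard, Finset.card_univ, Fintype.card_fin]
    by_cases hct : ct t ≤ k + 1
    · calc (ct t).factorial * (k + 1 - ct t).factorial * cand.card
          ≤ (ct t).factorial * (k + 1 - ct t).factorial * (k + 1).choose (ct t) := Nat.mul_le_mul_left _ hle
        _ = (k + 1).factorial := by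
            rw [mul_comm, ← mul_assoc]; exact Nat.choose_mul_factorial_mul_factorial hct
    · rw [Nat.choose_eq_zero_of_lt (by omega)] at hle
      have : cand.card = 0 := by omega
      rw [this, mul_zero]
      exact Nat.zero_le _
  -- (4) the sum is `weight · #touched`
  rw [Finset.sum_ite, Finset.sum_const_zero, add_zero, Finset.sum_const, smul_eq_mul, mul_comm]
  calc (ct t).factorial * (k + 1 - ct t).factorial * (Finset.univ.filter fun σ : Equiv.Perm (Fin m) =>
          ∃ v : Fin (k + 1) → Fin (k + 1), coeff (graphMonomial (tauD hd σ v)) (P t * Q t) ≠ 0).card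
      ≤ (ct t).factorial * (k + 1 - ct t).factorial * (cand.card * (s.factorial * (m - s).factorial)) :=
        Nat.mul_le_mul_left _ hT
    _ = ((ct t).factorial * (k + 1 - ct t).factorial * cand.card) * (s.factorial * (m - s).factorial) := by ring
    _ ≤ (k + 1).factorial * (s.factorial * (m - s).factorial) := Nat.mul_le_mul_right _ hwc

/-- **Demand.**  Under `LaplaceOptimal (k + 1)`, every permutation `σ` collects at least `(k+1)!`: the blocks of the
touching nodes are split-rank-one terms `u_t(v|_{S_t}) · w_t(v|_{S_tᶜ})` with `|S_t| = ct t` (unique factorisation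
and `ct_eq_of_mem_support_tauD`), summing to the permutation pattern (`coeff_tauD_perPoly`). -/
theorem factorial_le_sum_scoreD (hL : LaplaceOptimal (k + 1)) (hP : ∀ t, IsTiedTyped m k (I t) (c t) (ct t) (P t))
    (hQ : ∀ t, IsTiedTyped m k (I t)ᶜ (c' t) (ct' t) (Q t)) (hperm : perPoly (Fin m) ℂ = ∑ t, P t * Q t)
    (σ : Equiv.Perm (Fin m)) :
    (k + 1).factorial ≤ ∑ t : Fin w,
      if (∃ v : Fin (k + 1) → Fin (k + 1), coeff (graphMonomial (tauD hd σ v)) (P t * Q t) ≠ 0)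
      then (ct t).factorial * (k + 1 - ct t).factorial else 0 := by
  set T := Finset.univ.filter fun t : Fin w =>
    ∃ v : Fin (k + 1) → Fin (k + 1), coeff (graphMonomial (tauD hd σ v)) (P t * Q t) ≠ 0 with hT
  -- the split-rank-one terms of the touching nodes
  set S : Fin w → Finset (Fin (k + 1)) := fun t =>
    Finset.univ.filter fun i : Fin (k + 1) => σ.symm (Fin.castLE hd i) ∈ I t with hS
  set u : Fin w → (Fin (k + 1) → Fin (k + 1)) → ℂ := fun t v =>
    coeff (graphMonomialOn (I t) (tauD hd σ v)) (P t) with hu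
  set w' : Fin w → (Fin (k + 1) → Fin (k + 1)) → ℂ := fun t v =>
    coeff (graphMonomialOn (I t)ᶜ (tauD hd σ v)) (Q t) with hw'
  have hsum : ∀ v : Fin (k + 1) → Fin (k + 1),
      (∑ t ∈ T, u t v * w' t v) = if Function.Injective v then 1 else 0 := by
    intro v
    calc (∑ t ∈ T, u t v * w' t v)
        = ∑ t ∈ T, coeff (graphMonomial (tauD hd σ v)) (P t * Q t) :=
          Finset.sum_congr rfl fun t _ => (coeff_graphMonomial_mul_of_isTiedTyped (hP t) (hQ t) _).symm
      _ = ∑ t, coeff (graphMonomial (tauD hd σ v)) (P t * Q t) := by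
          refine Finset.sum_subset (Finset.filter_subset _ _) fun t _ ht => ?_
          by_contra hne
          exact ht (Finset.mem_filter.2 ⟨Finset.mem_univ _, v, hne⟩)
      _ = coeff (graphMonomial (tauD hd σ v)) (perPoly (Fin m) ℂ) := by rw [hperm, coeff_sum]
      _ = if Function.Injective v then 1 else 0 := coeff_tauD_perPoly hd σ v
  have hmemS : ∀ t (i : Fin (k + 1)), i ∈ S t ↔ σ.symm (Fin.castLE hd i) ∈ I t := fun t i => by
    simp [hS]
  have hu_dep : ∀ t, ∀ v v' : Fin (k + 1) → Fin (k + 1), (∀ i ∈ S t, v i = v' i) → u t v = u t v' := by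
    intro t v v' h
    show coeff (graphMonomialOn (I t) (tauD hd σ v)) (P t) = coeff (graphMonomialOn (I t) (tauD hd σ v')) (P t)
    rw [graphMonomialOn_tauD_congr hd σ (I t) fun i hi => h i ((hmemS t i).2 hi)]
  have hw_dep : ∀ t, ∀ v v' : Fin (k + 1) → Fin (k + 1), (∀ i, i ∉ S t → v i = v' i) → w' t v = w' t v' := by
    intro t v v' h
    show coeff (graphMonomialOn (I t)ᶜ (tauD hd σ v)) (Q t) = coeff (graphMonomialOn (I t)ᶜ (tauD hd σ v')) (Q t)
    rw [graphMonomialOn_tauD_congr hd σ (I t)ᶜ fun i hi =>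
      h i (fun hi' => (Finset.mem_compl.1 hi) ((hmemS t i).1 hi'))]
  have hLap := hL w T S u w' hu_dep hw_dep hsum
  -- the weights of the touching nodes are their tied totals
  have hscore : (∑ t : Fin w,
      if (∃ v : Fin (k + 1) → Fin (k + 1), coeff (graphMonomial (tauD hd σ v)) (P t * Q t) ≠ 0)
      then (ct t).factorial * (k + 1 - ct t).factorial else 0) =
      ∑ t ∈ T, (S t).card.factorial * (k + 1 - (S t).card).factorial := by
    rw [Finset.sum_ite, Finset.sum_const_zero, add_zero]
    refine Finset.sum_congr rfl fun t ht => ?_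
    obtain ⟨v, hne⟩ := (Finset.mem_filter.1 ht).2
    rw [coeff_graphMonomial_mul_of_isTiedTyped (hP t) (hQ t)] at hne
    have hsupp : graphMonomialOn (I t) (tauD hd σ v) ∈ (P t).support :=
      mem_support_iff.2 (left_ne_zero_of_mul hne)
    rw [ct_eq_of_mem_support_tauD hd (hP t) σ hsupp]
  rw [hscore]
  exact hLap

/-! ### §4 The count and the engine theorem -/

/-- **The count** under `LaplaceOptimal (k + 1)`: demand `(k+1)! · m!` against supply `w · (k+1)! · s!(m-s)!`. -/
theorem choose_le_of_laplaceOptimal (hkm : k + 1 ≤ m) (hL : LaplaceOptimal (k + 1)) (hs : s ≤ m)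
    (hcard : ∀ t, (I t).card = s)
    (hP : ∀ t, IsTiedTyped m k (I t) (c t) (ct t) (P t)) (hQ : ∀ t, IsTiedTyped m k (I t)ᶜ (c' t) (ct' t) (Q t))
    (hperm : perPoly (Fin m) ℂ = ∑ t, P t * Q t) : m.choose s ≤ w := by
  have hF : 0 < s.factorial * (m - s).factorial := Nat.mul_pos (Nat.factorial_pos _) (Nat.factorial_pos _)
  have hK : 0 < (k + 1).factorial := Nat.factorial_pos _
  have h1 : (k + 1).factorial * m.factorial ≤ ∑ σ : Equiv.Perm (Fin m), ∑ t : Fin w,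
      if (∃ v : Fin (k + 1) → Fin (k + 1), coeff (graphMonomial (tauD hkm σ v)) (P t * Q t) ≠ 0)
      then (ct t).factorial * (k + 1 - ct t).factorial else 0 := by
    calc (k + 1).factorial * m.factorial = ∑ _σ : Equiv.Perm (Fin m), (k + 1).factorial := by
          rw [Finset.sum_const, smul_eq_mul, Finset.card_univ, Fintype.card_perm, Fintype.card_fin, mul_comm]
      _ ≤ _ := Finset.sum_le_sum fun σ _ => factorial_le_sum_scoreD hkm I c c' ct ct' P Q hL hP hQ hperm σ
  have h2 : (∑ σ : Equiv.Perm (Fin m), ∑ t : Fin w,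
      if (∃ v : Fin (k + 1) → Fin (k + 1), coeff (graphMonomial (tauD hkm σ v)) (P t * Q t) ≠ 0)
      then (ct t).factorial * (k + 1 - ct t).factorial else 0) ≤
      w * ((k + 1).factorial * (s.factorial * (m - s).factorial)) := by
    rw [Finset.sum_comm]
    calc _ ≤ ∑ _t : Fin w, (k + 1).factorial * (s.factorial * (m - s).factorial) :=
          Finset.sum_le_sum fun t _ => sum_scoreD_le hkm I c c' ct ct' P Q (hcard t) (hP t) (hQ t)
      _ = w * ((k + 1).factorial * (s.factorial * (m - s).factorial)) := by
          rw [Finset.sum_const, smul_eq_mul, Finset.card_univ, Fintype.card_fin]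
  have h3 : (k + 1).factorial * (m.choose s * (s.factorial * (m - s).factorial)) ≤
      (k + 1).factorial * (w * (s.factorial * (m - s).factorial)) := by
    have hfact : m.choose s * (s.factorial * (m - s).factorial) = m.factorial := by
      rw [← mul_assoc]; exact Nat.choose_mul_factorial_mul_factorial hs
    rw [hfact]
    calc (k + 1).factorial * m.factorial ≤ _ := h1.trans h2
      _ = (k + 1).factorial * (w * (s.factorial * (m - s).factorial)) := by ring
  exact Nat.le_of_mul_le_mul_right (Nat.le_of_mul_le_mul_left h3 hK) hF

/-- **The engine.**  If Laplace expansion is optimal for the permutation pattern of order `k + 1`, then every level-`s`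
typed decomposition of `perm_m` with the columns `0, …, k` tied (`k + 1 ≤ m`, `s ≤ m`) uses at least `C(m, s)` products.
With `LaplaceOptimal 2` and `LaplaceOptimal 3` this recovers `stub_levelBound` and `levelBound_threeTied`; a proof of
`LaplaceOptimal 4` would give the level count for four tied columns.  HONEST FRAMING: helper toward the rungs
`TiedTorusBound k` of crux `RankRigidMinimalRepr`; no bearing on `VP ≠ VNP`. -/
theorem levelBound_of_laplaceOptimal (hL : LaplaceOptimal (k + 1)) :
    ∀ m : ℕ, k + 1 ≤ m → ∀ s w : ℕ, s ≤ m → TiedLevelDecomposable m k s w → m.choose s ≤ w := by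
  intro m hm s w hs hdec
  obtain ⟨I, c, c', ct, ct', P, Q, hcard, hP, hQ, -, -, hperm⟩ := hdec
  exact choose_le_of_laplaceOptimal I c c' ct ct' P Q hm hL hs hcard hP hQ hperm

end

end Summit.ValiantsHypothesis.ValiantsHypothesis.Theorems.RigidityForcesSymmetryRankRigidMinimalRepr
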